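import Summits.QuantumFields.BalabanUV.T4Continuum.Spine.NE5.EnvelopeOnRecordWitness

/-!
# Spine/NE5/EnvelopeOnRecordWitnessData — row NE5 (node U3): the H-LAYER END of record FIRES with DATA-DEPENDENT holomorphic
# activities on a BOUNDED admissible class, the levels obtained by the SCALE INDUCTION (companion of `EnvelopeOnRecordWitness`)

Cell `pub-balaban-gaps` (YM blitz Y1, track G2), seat `ne5` gen 4 (`prover-pub-balaban-gaps-ne5-g4-0`), triage sheet `HOME/ne/NE5.md`
v4 §5 row E6 ∕ §10.  Imports `Spine/NE5/EnvelopeOnRecordWitness` (this seat: the constant-activity witness, its table averages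
`scaleAvg` and linear history insertions `wIns` with their lemmas); modifies nothing.

WHY.  `EnvelopeOnRecordWitness` discharges every binder of the H-layer END `EnvelopeOnRecord.ne5_of_leaves_fibre_activities_record_eps`
with an activity CONSTANT in the data (honest limit (i) there: with `Base := univ` Liouville forces constancy).  This file removes that
limit: the activities are `a·e^{−R_d·d(Z)}·(o + h)·S⁻¹` — holomorphic and GENUINELY DEPENDENT on the operator datum `o` and the inserted
history `h` — the admissible class is the BOUNDED box `Base = B̄(0, δ) × B̄(0, 2c_H·G_w)`, and the one-run levels L05 ∕ L06 together with the
membership leaf L03 (`InBase`) are obtained by the SCALE INDUCTION of the renormalisation-group recursion: at step `k` the inserted history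
reads the recursively defined outputs of scales `< k` (blindness), which obey the level `G_w·e^{−κd}` by induction, so the insertion has
norm `≤ c_H·Σ_{j<k}(½)^{k−1−j}·G_w ≤ 2c_H·G_w`, the data point is admissible, and the tree's W2 theorem
`EnvelopeOnRecord.outputEnvelope_of_activities_record` bounds the new output by `G_w·e^{−κd}` again (`abs_recB_le`, `abs_recTableA_le`).
With the two runs' operator data `δ·θ^k` ∕ `0` (row NE2's shape L07 non-trivially) the outputs of the two runs now GENUINELY DIFFER and
the END's internal Cauchy estimate on the box (W2), the operator rate (W1) and the history feedback (W3, gain `c_H > 0`, `ω = ½`) are all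
exercised: `end_fires_data`, `exists_end_fires_data` (explicit positive `a, δ, c_H` for every target rate `θ′ ∈ (½, 1]`).

HONEST FRAMING.  A CONSISTENCY ∕ INTEGRATION witness of the END's binder list with zero classification weight: `Op = Hist = ℂ` and the
activities, operator data and insertions are toys; the torus catalogue `tsys 4 (R.cubesPerDir j)`, `locE`, the tree length, the
located numerals and the W2 theorem are the tree's.  Nothing of [Balaban1988RG2Cluster]'s objects is modelled or asserted.  NE5
(`T4OutputRate.NE5`) is a cell NEW ESTIMATE — NOT PRINTED (GAPS G-t4-U3-1) and NOT PROVED; 0∕12 leaves on Bałaban's objects; spine PROVED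
0∕9; rung (B)+1 bookkeeping on a FIXED finite T⁴ — NOT the continuum limit, NOT infinite volume, NOT a mass gap, NOT Clay.  HONEST
DEPENDENCY: continuum YM on T⁴ ⇐ BetaPertH ∧ nine spine estimates (0/9 proved); BetaPertH ⇐ (D1) ∧ (D4) ∧ CAP+tail.  0 sorry; axioms
standard; no cite tags (nothing printed is asserted).
-/

noncomputable section

open Set Metric
open scoped BigOperators

namespace Summit.QuantumFields.BalabanUV.T4Continuum.Spine.NE5.EnvelopeOnRecordWitnessData

open Literature.MathematicalPhysics.QuantumFieldTheory.Balaban1983to89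
open Literature.MathematicalPhysics.QuantumFieldTheory.Balaban1983to89.T4OutputRate
open Literature.MathematicalPhysics.QuantumFieldTheory.Balaban1983to89.T4InputCauchyRateData
open Literature.MathematicalPhysics.QuantumFieldTheory.Balaban1983to89.B13Resummation (locE)
open Literature.MathematicalPhysics.QuantumFieldTheory.Balaban1983to89.TreeLengthTorus (TPt TDom tsys torusTreeLen)
open Literature.MathematicalPhysics.QuantumFieldTheory.Balaban1983to89.TreeLengthTorusGeometry (TTouch)
open Literature.MathematicalPhysics.QuantumFieldTheory.Balaban1983to89.B12TreeDecay (K₀ K₀_pos)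
open Summit.QuantumFields.BalabanUV.T4Continuum.B13Carriers (TwoRuns)
open Summit.QuantumFields.BalabanUV.T4Continuum.StepRecursion
open Summit.QuantumFields.BalabanUV.T4Continuum.Spine.NE5
open Summit.QuantumFields.BalabanUV.T4Continuum.Spine.NE5.EnvelopeOnRecordWitness

variable {G : Type} [GaugeGroup G] (R : TwoRuns G)

/-! ## §1 The level constant, the data-dependent activity, the history bound from levels at earlier scales -/

/-- [folklore] The one-run LEVEL the W2 theorem delivers for majorant constant `a`: `G_w(a) = e·9·64·K₀(64,8)²·a`. -/
def Gw (a : ℝ) : ℝ := Real.exp 1 * 9 * 64 * K₀ 64 8 ^ 2 * a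

/-- [folklore] `G_w(a) ≥ 0` for `a ≥ 0`. -/
theorem Gw_nonneg {a : ℝ} (ha : 0 ≤ a) : 0 ≤ Gw a := by
  have : 0 ≤ K₀ 64 8 := (K₀_pos 64 8).le
  unfold Gw; positivity

/-- [folklore] The DATA-DEPENDENT witness activity at scale `j`: `(z, Z) ↦ a·e^{−R_d·d(Z)}·(z.1 + z.2)·S⁻¹` — holomorphic and non-constant
in the operator datum `z.1` and the inserted history `z.2`. -/
def dAct (a Rd S : ℝ) (j : ℕ) (z : ℂ × ℂ) (Z : TDom 4 (R.cubesPerDir j)) : ℂ :=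
  ((a * Real.exp (-(Rd * torusTreeLen Z.1)) : ℝ) : ℂ) * ((z.1 + z.2) * (S : ℂ)⁻¹)

/-- [folklore] The activity is ℂ-differentiable in the data on every set. -/
theorem differentiableOn_dAct (a Rd S : ℝ) (j : ℕ) (Z : TDom 4 (R.cubesPerDir j)) (V : Set (ℂ × ℂ)) :
    DifferentiableOn ℂ (fun z : ℂ × ℂ => dAct R a Rd S j z Z) V := by
  have h : Differentiable ℂ (fun z : ℂ × ℂ => (z.1 + z.2) * (S : ℂ)⁻¹) :=
    (differentiable_fst.add differentiable_snd).mul_const _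
  unfold dAct
  exact (differentiableOn_const _).mul h.differentiableOn

/-- [folklore] The majorant: where `‖z.1 + z.2‖ ≤ S` (`S > 0`), `‖dAct‖ ≤ a·e^{−R_d·d(Z)}`. -/
theorem norm_dAct_le {a S : ℝ} (ha : 0 ≤ a) (hS : 0 < S) (Rd : ℝ) (j : ℕ) (Z : TDom 4 (R.cubesPerDir j)) {z : ℂ × ℂ}
    (hz : ‖z.1 + z.2‖ ≤ S) : ‖dAct R a Rd S j z Z‖ ≤ a * Real.exp (-(Rd * torusTreeLen Z.1)) := by
  rw [dAct, norm_mul, norm_mul, norm_inv, Complex.norm_real, Complex.norm_real, Real.norm_eq_abs, Real.norm_eq_abs,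
    abs_of_nonneg (mul_nonneg ha (Real.exp_pos _).le), abs_of_pos hS]
  exact mul_le_of_le_one_right (mul_nonneg ha (Real.exp_pos _).le) ((mul_inv_le_iff₀ hS).2 (by rwa [one_mul]))

/-- [folklore] THE HISTORY BOUND FROM LEVELS AT EARLIER SCALES: a table whose entries of scale `< k` obey `|t Y| ≤ T·e^{−κ d(Y)}` is
inserted at step `k` with norm `≤ 2·c_H·T` (`Σ_{j<k} (½)^{k−1−j} ≤ 2`). -/
theorem norm_wIns_le_of_levels {κ cH T : ℝ} (hcH : 0 ≤ cH) (hT : 0 ≤ T) {k : ℕ} {t : R.carriers.Dom → ℝ}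
    (ht : ∀ Y : R.carriers.Dom, R.carriers.scale Y < k → |t Y| ≤ T * Real.exp (-(κ * R.carriers.d Y))) :
    ‖wIns R κ cH k t‖ ≤ 2 * cH * T := by
  have havg : ∀ j ∈ Finset.range k, |scaleAvg R κ j t| ≤ T := fun j hj =>
    abs_scaleAvg_le R κ j fun X => by
      have h := ht (R.mkDom j X) (by rw [R.scale_mkDom]; exact Finset.mem_range.1 hj)
      rwa [R.d_mkDom] at h
  have hgeom : ∑ j ∈ Finset.range k, (1 / 2 : ℝ) ^ (k - 1 - j) ≤ 2 := by
    have h : ∑ j ∈ Finset.range k, (1 / 2 : ℝ) ^ (k - 1 - j) = ∑ j ∈ Finset.range k, (1 / 2 : ℝ) ^ j :=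
      Finset.sum_range_reflect (fun i => (1 / 2 : ℝ) ^ i) k
    rw [h]
    exact sum_geometric_two_le k
  rw [wIns, Complex.norm_real, Real.norm_eq_abs, abs_mul, abs_of_nonneg hcH]
  calc cH * |∑ j ∈ Finset.range k, (1 / 2 : ℝ) ^ (k - 1 - j) * scaleAvg R κ j t|
      ≤ cH * ∑ j ∈ Finset.range k, (1 / 2 : ℝ) ^ (k - 1 - j) * T := by
        refine mul_le_mul_of_nonneg_left ((Finset.abs_sum_le_sum_abs _ _).trans (Finset.sum_le_sum fun j hj => ?_)) hcH
        rw [abs_mul, abs_of_nonneg (pow_nonneg (by norm_num) _)]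
        exact mul_le_mul_of_nonneg_left (havg j hj) (pow_nonneg (by norm_num) _)
    _ = cH * ((∑ j ∈ Finset.range k, (1 / 2 : ℝ) ^ (k - 1 - j)) * T) := by rw [Finset.sum_mul]
    _ ≤ cH * (2 * T) := mul_le_mul_of_nonneg_left (mul_le_mul_of_nonneg_right hgeom hT) hcH
    _ = 2 * cH * T := by ring

/-! ## §2 The data-dependent witness model: bounded admissible class -/

variable [∀ j, DecidableEq (TDom 4 (R.cubesPerDir j))] [∀ j, DecidableRel (TTouch (d := 4) (N := R.cubesPerDir j))]

/-- [folklore] The normalising radius `S = δ + 2c_H·G_w(a) + 4`: the sup of `‖o‖ + ‖h‖` over the `2`-neighbourhoods of the base box. -/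
def Srad (a δ cH : ℝ) : ℝ := δ + 2 * cH * Gw a + 4

/-- [folklore] **THE DATA-DEPENDENT WITNESS MODEL** over `R.carriers`, `Op = Hist = ℂ`: output := (2.13) of the data-dependent
activities `dAct`; run A's operator datum `δ·θ^k`, run B's `0`; both runs insert histories by `wIns` (gain `c_H`, weight `½`); admissible
class = the BOUNDED box `B̄(0, δ) × B̄(0, 2c_H·G_w(a))`; unit margins. -/
def dModel (a Rd κ δ θ cH : ℝ) : StepModel R.carriers ℂ ℂ where
  Out := fun _ o h X =>
    locE (TTouch (d := 4) (N := R.cubesPerDir X.1)) (fun Z : (tsys 4 (R.cubesPerDir X.1)).Dom => Z.1)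
      (fun Z => dAct R a Rd (Srad a δ cH) X.1 (o, h) Z) X.2.1
  opA := fun _ _ k => ((δ * θ ^ k : ℝ) : ℂ)
  opB := fun _ _ _ => 0
  insA := fun _ _ k t => wIns R κ cH k t
  insB := fun _ _ k t => wIns R κ cH k t
  Base := fun _ _ _ => closedBall (0 : ℂ) δ ×ˢ closedBall (0 : ℂ) (2 * cH * Gw a)
  rOp := fun _ => 1
  rHist := fun _ => 1
  rOp_pos := fun _ => one_pos
  rHist_pos := fun _ => one_pos

/-- [folklore] The activities as a data-indexed family (the END's `act`). -/
def dActD (a Rd δ cH : ℝ) : (j : ℕ) → ℂ × ℂ → TDom 4 (R.cubesPerDir j) → ℂ :=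
  fun j z Z => dAct R a Rd (Srad a δ cH) j z Z
set_option maxHeartbeats 400000 in
/-- [folklore] `hrep` of the END for the data-dependent model — by `rfl`. -/
theorem hrep_dModel (a Rd κ δ θ cH : ℝ) : ∀ (X : R.carriers.Dom) (z : ℂ × ℂ),
    (dModel R a Rd κ δ θ cH).Out X.1 z.1 z.2 X =
      locE (TTouch (d := 4) (N := R.cubesPerDir X.1)) (fun Z : (tsys 4 (R.cubesPerDir X.1)).Dom => Z.1)
        (dActD R a Rd δ cH X.1 z) X.2.1 :=
  fun _ _ => rfl

/-- [folklore] **`hH` of the END, NON-TRIVIALLY**: around every admissible data point `p ∈ B̄(0,δ) × B̄(0, 2c_H G_w)` the open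
neighbourhood `V = B(p.1, 2) × B(p.2, 2)` of the unit box carries activities that are holomorphic and NON-CONSTANT in the data and
obey the data-uniform majorant `a·e^{−R_d·d(Z)}` (on `V`, `‖o + h‖ ≤ δ + 2c_H G_w + 4 = S`). -/
theorem hH_dModel {a δ cH : ℝ} (ha : 0 ≤ a) (hδ : 0 ≤ δ) (hcH : 0 ≤ cH) (Rd κ θ : ℝ) (W : Set (ℕ → ℝ)) :
    ∀ j, ∀ g ∈ W, ∀ (U : R.carriers.BgB) (p : ℂ × ℂ), p ∈ (dModel R a Rd κ δ θ cH).Base j g U →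
      ∃ V : Set (ℂ × ℂ), IsOpen V ∧ (dModel R a Rd κ δ θ cH).box j p ⊆ V ∧
        (∀ Z : TDom 4 (R.cubesPerDir j), DifferentiableOn ℂ (fun z : ℂ × ℂ => dActD R a Rd δ cH j z Z) V) ∧
        (∀ z ∈ V, ∀ Z : TDom 4 (R.cubesPerDir j), ‖dActD R a Rd δ cH j z Z‖ ≤ a * Real.exp (-(Rd * torusTreeLen Z.1))) := by
  intro j g _ U p hp
  have hS : 0 < Srad a δ cH := by
    have := Gw_nonneg ha; unfold Srad; positivity
  refine ⟨ball p.1 2 ×ˢ ball p.2 2, isOpen_ball.prod isOpen_ball,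
    Set.prod_mono (closedBall_subset_ball (by change (1 : ℝ) < 2; norm_num))
      (closedBall_subset_ball (by change (1 : ℝ) < 2; norm_num)),
    fun Z => differentiableOn_dAct R a Rd _ j Z _, fun z hz Z => norm_dAct_le R ha hS Rd j Z ?_⟩
  obtain ⟨hp1, hp2⟩ := hp
  rw [mem_closedBall_zero_iff] at hp1 hp2
  obtain ⟨hz1, hz2⟩ := hz
  rw [mem_ball, dist_eq_norm] at hz1 hz2
  calc ‖z.1 + z.2‖ ≤ ‖z.1‖ + ‖z.2‖ := norm_add_le _ _
    _ ≤ (‖p.1‖ + ‖z.1 - p.1‖) + (‖p.2‖ + ‖z.2 - p.2‖) := add_le_add (norm_le_norm_add_norm_sub' _ _) (norm_le_norm_add_norm_sub' _ _)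
    _ ≤ (δ + 2) + (2 * cH * Gw a + 2) := by linarith
    _ = Srad a δ cH := by unfold Srad; ring

/-- [folklore] `ReadsTransported`: run A's data do not depend on the background. -/
theorem readsTransported_dModel {a Rd κ δ θ cH : ℝ} (W : Set (ℕ → ℝ)) : ReadsTransported (dModel R a Rd κ δ θ cH) W :=
  fun _ _ _ _ _ => ⟨fun _ => rfl, fun _ _ => rfl⟩

/-- [folklore] L09blind. -/
theorem insBlind_dModel {a Rd κ δ θ cH : ℝ} (W : Set (ℕ → ℝ)) : (dModel R a Rd κ δ θ cH).InsBlind W :=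
  fun k _ _ _ _ _ h => wIns_congr R κ cH k h

/-- [folklore] Run B's blindness. -/
theorem insBlindB_dModel {a Rd κ δ θ cH : ℝ} (W : Set (ℕ → ℝ)) : InsBlindB (dModel R a Rd κ δ θ cH) W :=
  fun k _ _ _ _ _ h => wIns_congr R κ cH k h

/-- [folklore] L09aff. -/
theorem insAffine_dModel {a Rd κ δ θ cH : ℝ} (W : Set (ℕ → ℝ)) : (dModel R a Rd κ δ θ cH).InsAffine W := by
  intro k g _ U t t'
  change wIns R κ cH k t - wIns R κ cH k t' = wIns R κ cH k (t - t') - wIns R κ cH k 0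
  rw [wIns_sub, wIns_zero, sub_zero]

/-- [folklore] L09hom. -/
theorem insHomog_dModel {a Rd κ δ θ cH : ℝ} (W : Set (ℕ → ℝ)) : (dModel R a Rd κ δ θ cH).InsHomog W := by
  intro k g _ U c t
  change wIns R κ cH k (c • t) - wIns R κ cH k 0 = (c : ℂ) • (wIns R κ cH k t - wIns R κ cH k 0)
  rw [wIns_smul, wIns_zero, sub_zero, sub_zero, smul_eq_mul]

/-- [folklore] L09unit (`InsScaleBound W κ E₁ c_H ½`) for every level `E₁`. -/
theorem insScaleBound_dModel {a Rd κ δ θ cH : ℝ} (hcH : 0 ≤ cH) (W : Set (ℕ → ℝ)) (E₁ : ℝ) :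
    (dModel R a Rd κ δ θ cH).InsScaleBound W κ E₁ cH (1 / 2) := by
  intro k g _ U t j hjk hsupp hsize
  change ‖wIns R κ cH k t - wIns R κ cH k 0‖ ≤ 1 * (cH * ((1 / 2 : ℝ) ^ (k - 1 - j) * E₁))
  rw [wIns_zero, sub_zero, one_mul]
  exact norm_wIns_le R hcH hjk hsupp hsize

/-- [folklore] L07 non-trivially: the runs' operator data differ by exactly `δ·θ^k` margins. -/
theorem operatorRate_dModel {a Rd κ δ θ cH : ℝ} (hδ : 0 ≤ δ) (hθ : 0 ≤ θ) (W : Set (ℕ → ℝ)) :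
    (dModel R a Rd κ δ θ cH).OperatorRate W δ θ := by
  intro k g _ U
  change ‖((δ * θ ^ k : ℝ) : ℂ) - 0‖ ≤ δ * θ ^ k * 1
  rw [sub_zero, Complex.norm_real, Real.norm_eq_abs, abs_of_nonneg (mul_nonneg hδ (pow_nonneg hθ _)), mul_one]

/-- [folklore] L08 (`InsertionRate W κ E₀ 0 θ`). -/
theorem insertionRate_dModel {a Rd κ δ θ cH : ℝ} (W : Set (ℕ → ℝ)) (E₀ θ' : ℝ) :
    (dModel R a Rd κ δ θ cH).InsertionRate W κ E₀ 0 θ' := by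
  intro k g _ U t _
  change ‖wIns R κ cH k t - wIns R κ cH k t‖ ≤ 0 * θ' ^ k * 1
  rw [sub_self, norm_zero, zero_mul, zero_mul]

/-! ## §3 THE SCALE INDUCTION: levels of the recursively defined outputs from the W2 theorem, scale by scale -/

/-- [folklore] The output envelope of the data-dependent model FROM THE TREE'S W2 THEOREM (`outputEnvelope_of_activities_record`). -/
theorem outputEnvelope_dModel {a κ δ cH : ℝ} (ha : 0 ≤ a) (hδ : 0 ≤ δ) (hcH : 0 ≤ cH) (hκ : 0 ≤ κ) {Rd : ℝ}
    (hrate : κ + 2 * (64 * Real.log 162) + 2 ≤ Rd) (hKP : a * Real.exp (5 * κ + 1) * K₀ 64 8 * 9 * 64 ≤ 1) (θ : ℝ)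
    (W : Set (ℕ → ℝ)) : (dModel R a Rd κ δ θ cH).OutputEnvelope W κ (Gw a) :=
  outputEnvelope_of_activities_record R (dModel R a Rd κ δ θ cH) (act := dActD R a Rd δ cH) (hrep_dModel R a Rd κ δ θ cH)
    ha hκ hrate hKP (hH_dModel R ha hδ hcH Rd κ θ W)

/-- [folklore] Hence: an output at an ADMISSIBLE data point is at most `G_w·e^{−κ d(X)}`. -/
theorem norm_out_le_of_mem {a κ δ cH : ℝ} (ha : 0 ≤ a) (hδ : 0 ≤ δ) (hcH : 0 ≤ cH) (hκ : 0 ≤ κ) {Rd : ℝ}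
    (hrate : κ + 2 * (64 * Real.log 162) + 2 ≤ Rd) (hKP : a * Real.exp (5 * κ + 1) * K₀ 64 8 * 9 * 64 ≤ 1) (θ : ℝ)
    {W : Set (ℕ → ℝ)} {g : ℕ → ℝ} (hg : g ∈ W) (U : R.carriers.BgB) {o h : ℂ} (X : R.carriers.Dom)
    (hz : (o, h) ∈ (dModel R a Rd κ δ θ cH).Base (R.carriers.scale X) g U) :
    ‖(dModel R a Rd κ δ θ cH).Out (R.carriers.scale X) o h X‖ ≤ Gw a * Real.exp (-(κ * R.carriers.d X)) :=
  (outputEnvelope_dModel R ha hδ hcH hκ hrate hKP θ W (R.carriers.scale X) g hg U (o, h) hz X rfl).2 (o, h)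
    (Set.mk_mem_prod (mem_closedBall_self zero_le_one) (mem_closedBall_self zero_le_one))

/-- **THE SCALE INDUCTION FOR RUN B**: the recursively DEFINED output `recB` obeys the level `G_w·e^{−κd}` at EVERY scale — at step
`k` the inserted history reads outputs of scales `< k` only (blindness), bounded by induction, so `‖insB‖ ≤ 2c_H G_w`, the data point
is admissible, and the W2 theorem bounds the new output. [folklore] -/
theorem abs_recB_le {a κ δ θ cH : ℝ} (ha : 0 ≤ a) (hδ : 0 ≤ δ) (hcH : 0 ≤ cH) (hκ : 0 ≤ κ) {Rd : ℝ}
    (hrate : κ + 2 * (64 * Real.log 162) + 2 ≤ Rd) (hKP : a * Real.exp (5 * κ + 1) * K₀ 64 8 * 9 * 64 ≤ 1)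
    {W : Set (ℕ → ℝ)} {g : ℕ → ℝ} (hg : g ∈ W) (U : R.carriers.BgB) (k : ℕ) :
    ∀ X : R.carriers.Dom, R.carriers.scale X = k →
      |recB (dModel R a Rd κ δ θ cH) g U X| ≤ Gw a * Real.exp (-(κ * R.carriers.d X)) := by
  induction k using Nat.strong_induction_on with
  | _ k ih =>
    intro X hX
    subst hX
    -- the inserted history at this step reads earlier scales only, bounded by induction
    have hins : ‖wIns R κ cH (R.carriers.scale X) (tableB (recB (dModel R a Rd κ δ θ cH)) g U)‖ ≤ 2 * cH * Gw a :=
      norm_wIns_le_of_levels R hcH (Gw_nonneg ha) fun Y hY => ih _ hY Y rfl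
    -- hence run B's data point is admissible, and the W2 theorem bounds the new output
    have hbase : ((0 : ℂ), wIns R κ cH (R.carriers.scale X) (tableB (recB (dModel R a Rd κ δ θ cH)) g U)) ∈
        (dModel R a Rd κ δ θ cH).Base (R.carriers.scale X) g U :=
      Set.mk_mem_prod (mem_closedBall_self hδ) (mem_closedBall_zero_iff.2 hins)
    rw [representsB_recB (insBlindB_dModel (a := a) (Rd := Rd) (κ := κ) (δ := δ) (θ := θ) (cH := cH) R W) g hg U X]
    exact (Complex.abs_re_le_norm _).trans (norm_out_le_of_mem R ha hδ hcH hκ hrate hKP θ hg U X hbase)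

/-- **THE SCALE INDUCTION FOR RUN A** (the recursive table at a run-B background; run A's operator datum `δ·θ^k ∈ B̄(0,δ)` for
`0 ≤ θ ≤ 1`). [folklore] -/
theorem abs_recTableA_le {a κ δ θ cH : ℝ} (ha : 0 ≤ a) (hδ : 0 ≤ δ) (hθ : 0 ≤ θ) (hθ1 : θ ≤ 1) (hcH : 0 ≤ cH) (hκ : 0 ≤ κ)
    {Rd : ℝ} (hrate : κ + 2 * (64 * Real.log 162) + 2 ≤ Rd) (hKP : a * Real.exp (5 * κ + 1) * K₀ 64 8 * 9 * 64 ≤ 1)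
    {W : Set (ℕ → ℝ)} {g : ℕ → ℝ} (hg : g ∈ W) (U : R.carriers.BgB) (k : ℕ) :
    ∀ X : R.carriers.Dom, R.carriers.scale X = k →
      |recTableA (dModel R a Rd κ δ θ cH) g U X| ≤ Gw a * Real.exp (-(κ * R.carriers.d X)) := by
  induction k using Nat.strong_induction_on with
  | _ k ih =>
    intro X hX
    subst hX
    have hins : ‖wIns R κ cH (R.carriers.scale X) (recTableA (dModel R a Rd κ δ θ cH) g U)‖ ≤ 2 * cH * Gw a :=
      norm_wIns_le_of_levels R hcH (Gw_nonneg ha) fun Y hY => ih _ hY Y rfl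
    have hop : ‖((δ * θ ^ R.carriers.scale X : ℝ) : ℂ)‖ ≤ δ := by
      rw [Complex.norm_real, Real.norm_eq_abs, abs_of_nonneg (mul_nonneg hδ (pow_nonneg hθ _))]
      exact mul_le_of_le_one_right hδ (pow_le_one₀ hθ hθ1)
    have hbase : (((δ * θ ^ R.carriers.scale X : ℝ) : ℂ), wIns R κ cH (R.carriers.scale X) (recTableA (dModel R a Rd κ δ θ cH) g U)) ∈
        (dModel R a Rd κ δ θ cH).Base (R.carriers.scale X) g U :=
      Set.mk_mem_prod (mem_closedBall_zero_iff.2 hop) (mem_closedBall_zero_iff.2 hins)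
    have hfix := congrFun (causalFix_isFixedPt (causal_stepMapA (M := (dModel R a Rd κ δ θ cH)) (insBlind_dModel R W) hg U)) X
    change |causalFix R.carriers.scale (stepMapA (dModel R a Rd κ δ θ cH) g U) X| ≤ _
    rw [← hfix]
    exact (Complex.abs_re_le_norm _).trans (norm_out_le_of_mem R ha hδ hcH hκ hrate hKP θ hg U X hbase)

/-- [folklore] **L06 by the scale induction.** -/
theorem decayBound_recB_data {a κ δ θ cH : ℝ} (ha : 0 ≤ a) (hδ : 0 ≤ δ) (hcH : 0 ≤ cH) (hκ : 0 ≤ κ) {Rd : ℝ}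
    (hrate : κ + 2 * (64 * Real.log 162) + 2 ≤ Rd) (hKP : a * Real.exp (5 * κ + 1) * K₀ 64 8 * 9 * 64 ≤ 1)
    (W : Set (ℕ → ℝ)) : DecayBound (recB (dModel R a Rd κ δ θ cH)) W (Gw a) κ :=
  fun _ hg U X => abs_recB_le R ha hδ hcH hκ hrate hKP hg U _ X rfl

/-- [folklore] **L05 by the scale induction** (off the image of the transport `recA = 0`). -/
theorem decayBound_recA_data {a κ δ θ cH : ℝ} (ha : 0 ≤ a) (hδ : 0 ≤ δ) (hθ : 0 ≤ θ) (hθ1 : θ ≤ 1) (hcH : 0 ≤ cH)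
    (hκ : 0 ≤ κ) {Rd : ℝ} (hrate : κ + 2 * (64 * Real.log 162) + 2 ≤ Rd)
    (hKP : a * Real.exp (5 * κ + 1) * K₀ 64 8 * 9 * 64 ≤ 1) (W : Set (ℕ → ℝ)) :
    DecayBound (recA (dModel R a Rd κ δ θ cH)) W (Gw a) κ := by
  intro g hg V X
  unfold recA
  split_ifs with h
  · exact abs_recTableA_le R ha hδ hθ hθ1 hcH hκ hrate hKP hg _ _ X rfl
  · rw [abs_zero]; exact mul_nonneg (Gw_nonneg ha) (Real.exp_pos _).le

/-- [folklore] **L03 (`InBase`) NON-TRIVIALLY, by the scale induction**: run B's data lie in the bounded admissible box at every step. -/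
theorem inBase_dModel {a κ δ θ cH : ℝ} (ha : 0 ≤ a) (hδ : 0 ≤ δ) (hcH : 0 ≤ cH) (hκ : 0 ≤ κ) {Rd : ℝ}
    (hrate : κ + 2 * (64 * Real.log 162) + 2 ≤ Rd) (hKP : a * Real.exp (5 * κ + 1) * K₀ 64 8 * 9 * 64 ≤ 1)
    (W : Set (ℕ → ℝ)) : (dModel R a Rd κ δ θ cH).InBase (recB (dModel R a Rd κ δ θ cH)) W := by
  intro k g hg U
  exact Set.mk_mem_prod (mem_closedBall_self hδ) (mem_closedBall_zero_iff.2
    (norm_wIns_le_of_levels R hcH (Gw_nonneg ha) fun Y hY => abs_recB_le R ha hδ hcH hκ hrate hKP hg U _ Y rfl))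

/-! ## §4 THE END FIRES with data-dependent activities -/

/-- **THE H-LAYER END OF RECORD FIRES WITH DATA-DEPENDENT HOLOMORPHIC ACTIVITIES ON A BOUNDED ADMISSIBLE CLASS.**  For every `R`,
window `W`, `κ ≥ 0`, `0 ≤ θ ≤ θ′ ≤ 1` and `a, δ, c_H ≥ 0` obeying the [KP86] clause, the reach clause L10 and the sharp clause `hS`,
`EnvelopeOnRecord.ne5_of_leaves_fibre_activities_record_eps` applied to `dModel` — `hH` by `hH_dModel`, L03 ∕ L05 ∕ L06 BY THE SCALE
INDUCTION (§3), L01 ∕ L02 by `StepRecursion`, L07 ∕ L08 ∕ L09 by §2, letters `R_d := κ + 128·log 162 + 2`, `C₃ := a`, `ε₁ := 1`,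
`δ′ := 0`, `ω := ρ₀ := ½`, `k₀ := 0`, `B := 0`, `E₁ := 1`, `EA₀ = E₀ := G_w(a)` — yields NE5 for the two runs' recursively defined
outputs. [folklore] -/
theorem end_fires_data {W : Set (ℕ → ℝ)} {a κ δ θ θ' cH : ℝ} (ha : 0 ≤ a) (hκ : 0 ≤ κ) (hδ : 0 ≤ δ) (hθ : 0 ≤ θ)
    (hθθ' : θ ≤ θ') (hθ'1 : θ' ≤ 1) (hcH : 0 ≤ cH)
    (hKP : a * Real.exp (5 * κ + 1) * K₀ 64 8 * 9 * 64 ≤ 1)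
    (hnear : δ + cH * (Gw a + Gw a) / (1 - 1 / 2) ≤ 1 / 2) (hS : Gw a * cH < (θ' - 1 / 2) * (1 - 1 / 2)) :
    ∃ C₅ : ℝ, NE5 (recA (dModel R a (κ + 2 * (64 * Real.log 162) + 2) κ δ θ cH))
      (recB (dModel R a (κ + 2 * (64 * Real.log 162) + 2) κ δ θ cH)) W κ θ' C₅ := by
  have hrate : κ + 2 * (64 * Real.log 162) + 2 ≤ κ + 2 * (64 * Real.log 162) + 2 := le_rfl
  have hθ1 : θ ≤ 1 := hθθ'.trans hθ'1
  have hKP' : a * 1 * Real.exp (5 * κ + 1) * K₀ 64 8 * 9 * 64 ≤ 1 := by rw [mul_one]; exact hKP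
  have hS' : Real.exp 1 * 9 * 64 * K₀ 64 8 ^ 2 * a * cH * 1 < (θ' - 1 / 2) * (1 - 1 / 2) := by rw [mul_one]; exact hS
  have hnear' : (δ + 0) * θ ^ (0 : ℕ) +
      cH * (Real.exp 1 * 9 * 64 * K₀ 64 8 ^ 2 * a + Real.exp 1 * 9 * 64 * K₀ 64 8 ^ 2 * a) / (1 - 1 / 2) ≤ 1 / 2 := by
    rw [add_zero, pow_zero, mul_one]; exact hnear
  have hfirst : ∀ k < (0 : ℕ), Real.exp 1 * 9 * 64 * K₀ 64 8 ^ 2 * a + Real.exp 1 * 9 * 64 * K₀ 64 8 ^ 2 * a ≤ 0 * θ ^ k :=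
    fun k hk => absurd hk (Nat.not_lt_zero k)
  exact ⟨_, ne5_of_leaves_fibre_activities_record_eps R (dModel R a (κ + 2 * (64 * Real.log 162) + 2) κ δ θ cH)
    (act := dActD R a (κ + 2 * (64 * Real.log 162) + 2) δ cH)
    (hrep_dModel R a _ κ δ θ cH) ha zero_le_one hκ hrate hKP'
    (fun j g hg U p hp => by
      obtain ⟨V, h1, h2, h3, h4⟩ := hH_dModel R ha hδ hcH _ κ θ W j g hg U p hp
      exact ⟨V, h1, h2, h3, fun z hz Z => by rw [mul_one]; exact h4 z hz Z⟩)
    (representsA_recA (insBlind_dModel R W) (readsTransported_dModel R W))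
    (representsB_recB (insBlindB_dModel R W))
    (inBase_dModel R ha hδ hcH hκ hrate hKP W)
    (decayBound_recA_data R ha hδ hθ hθ1 hcH hκ hrate hKP W) (decayBound_recB_data R ha hδ hcH hκ hrate hKP W)
    (operatorRate_dModel R hδ hθ W) (insertionRate_dModel R W _ θ)
    (insAffine_dModel R W) (insBlind_dModel R W) (insHomog_dModel R W) (insScaleBound_dModel R hcH W 1)
    one_pos (by rw [add_zero]; exact hδ) hθ hθθ' hθ'1 hcH one_half_pos one_half_lt_one hnear' le_rfl hfirst hS'⟩

/-- **NON-DEGENERATE LETTERS FOR EVERY TARGET RATE `θ′ ∈ (½, 1]`** — the same explicit positive `a, δ = ¼, c_H = 1` as in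
`EnvelopeOnRecordWitness.exists_end_fires`, now for the data-dependent model. [folklore] -/
theorem exists_end_fires_data (W : Set (ℕ → ℝ)) {κ θ' : ℝ} (hκ : 0 ≤ κ) (hθ' : 1 / 2 < θ') (hθ'1 : θ' ≤ 1) :
    ∃ a δ cH : ℝ, 0 < a ∧ 0 < δ ∧ 0 < cH ∧ ∃ C₅ : ℝ,
      NE5 (recA (dModel R a (κ + 2 * (64 * Real.log 162) + 2) κ δ θ' cH))
        (recB (dModel R a (κ + 2 * (64 * Real.log 162) + 2) κ δ θ' cH)) W κ θ' C₅ := by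
  have hK : 0 < K₀ 64 8 := K₀_pos 64 8
  obtain ⟨E, hE, hEpos⟩ : ∃ E : ℝ, E = Real.exp 1 * 9 * 64 * K₀ 64 8 ^ 2 ∧ 0 < E := ⟨_, rfl, by positivity⟩
  obtain ⟨P, hP, hPpos⟩ : ∃ P : ℝ, P = Real.exp (5 * κ + 1) * K₀ 64 8 * 9 * 64 ∧ 0 < P := ⟨_, rfl, by positivity⟩
  have hθpos : 0 < θ' - 1 / 2 := sub_pos.2 hθ'
  obtain ⟨a, ha⟩ : ∃ a : ℝ, a = min (1 / (P + 1)) ((θ' - 1 / 2) / (8 * (E + 1))) := ⟨_, rfl⟩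
  have ha_pos : 0 < a := by rw [ha]; exact lt_min (div_pos one_pos (by linarith)) (div_pos hθpos (by positivity))
  have ha1 : a ≤ 1 / (P + 1) := by rw [ha]; exact min_le_left _ _
  have ha2 : a ≤ (θ' - 1 / 2) / (8 * (E + 1)) := by rw [ha]; exact min_le_right _ _
  have hEa : E * a ≤ (θ' - 1 / 2) / 8 := by
    refine (mul_le_mul_of_nonneg_left ha2 hEpos.le).trans ?_
    rw [mul_div_assoc', div_le_iff₀ (by positivity : (0 : ℝ) < 8 * (E + 1))]
    nlinarith
  have hPa : a * P ≤ 1 := by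
    refine (mul_le_mul_of_nonneg_right ha1 hPpos.le).trans ?_
    rw [div_mul_eq_mul_div, one_mul, div_le_one (by linarith)]
    linarith
  have hGw : Gw a = E * a := by rw [Gw, hE]
  refine ⟨a, 1 / 4, 1, ha_pos, by norm_num, one_pos, ?_⟩
  refine end_fires_data R ha_pos.le hκ (by norm_num) (by linarith) le_rfl hθ'1 zero_le_one ?_ ?_ ?_
  · calc a * Real.exp (5 * κ + 1) * K₀ 64 8 * 9 * 64 = a * P := by rw [hP]; ring
      _ ≤ 1 := hPa
  · have h4 : (1 : ℝ) / 4 + 1 * (E * a + E * a) / (1 - 1 / 2) = 1 / 4 + 4 * (E * a) := by ring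
    rw [hGw, h4]; linarith
  · rw [hGw]; linarith

end Summit.QuantumFields.BalabanUV.T4Continuum.Spine.NE5.EnvelopeOnRecordWitnessData
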